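import Literature.MathematicalPhysics.KineticTheory.ConfinedDriftKernel
import Literature.Probability.Process.BrownianSkeleton
import Literature.Analysis.ODE.ForcedSmoothDependence
import HarnessLib

/-!
# Additive-noise SDEs with a confined drift: the solution as a `C¹` function of the dyadic skeleton of the noise

Trunk T-KINETIC (Literature/MathematicalPhysics/KineticTheory). Model-free version of
`LangevinChainSkeletonFlow.lean` (there: the pinned chain and the older pipeline), for the pathwise
flow `drivenFlow` / solution map `sdeSolMap` of `dz = Y(z) dt + v₁ dB¹ + v₂ dB²` with a confined
drift (`ConfinedForcedFlow.lean`, `ConfinedDriftKernel.lean`). Conditionally on the Brownian bridges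
the pair of Brownian paths on `[0, 1]` is an affine function of its dyadic skeleton
`x ∈ (ℝ^{2^m})²` (`BrownianSkeleton.lean`: `pairPath = pairRecon (pairSkel) (pairRem)`), hence so is
the noise path, and the solution at time `1` is a function of the finite-dimensional Gaussian vector
`x`, of the initial condition `z`, and of the remainder noise path `ρ ∈ C([0,1], noise subspace)`:

* `skelNoisePath m v₁ v₂ x ρ` — the noise path `t ↦ ρ(t̄) + PL^m_{x₁}(t⁺) v₁ + PL^m_{x₂}(t⁺) v₂`;
  `skelForcingCLM` — the forcing `(z, x, ρ) ↦ z + n_{x,ρ}` as a continuous LINEAR map into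
  `C(I, E)`; `remNoisePath` — the remainder noise `τ ↦ R¹_τ v₁ + R²_τ v₂` of a pair of paths;
* `ConfinedDrift.exists_skelSol` — **the solution family** `S(z, x, ρ) = (τ ↦ Φ_τ(z, n_{x,ρ}))`
  is the unique zero of the parametric Robbin map `α ↦ g(z,x,ρ) + ∫₀ Y∘α - α` and is `C^n` jointly
  in `(z, x, ρ)` when `Y ∈ C^n`, `n ≥ 1` (implicit function theorem for forced integral equations,
  `Literature/Analysis/ODE/ForcedSmoothDependence.lean`) — `C¹` drifts are allowed (the
  Hairer–Mattingly chain);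
* `ConfinedDrift.skelSol_equilibrium` — at an equilibrium `x₀` (`Y x₀ = 0`) and zero noise the
  solution is the constant path; `ConfinedDrift.sdeSolMap_one_eq_skelSol` — for the Brownian pair
  `ω`, `Φ_1(z, B(ω)) = S(z, pairSkel m ω, ρ_ω)(1)`.

This is the first step of the Hörmander-free LOCAL MINORISATION of the transition probabilities near
an equilibrium (finite-dimensional "partial Malliavin calculus").

## References

* N. Cuneo, J.-P. Eckmann, M. Hairer, L. Rey-Bellet, EJP **23** (2018) no. 55, Prop. 3.6 (proof).
* J. C. Mattingly, É. Pardoux, CPAM **59** (2006); D. Nualart, *The Malliavin Calculus and Related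
  Topics* (2006), §2.3. [folklore]
-/

noncomputable section

open MeasureTheory Filter Topology Set Metric Function unitInterval
open scoped NNReal

namespace Literature.MathematicalPhysics.KineticTheory

open Literature.Probability.Process Literature.Analysis.ODE

variable {E : Type*} [NormedAddCommGroup E] [NormedSpace ℝ E]

/-! ### The noise path of a skeleton and a remainder -/

/-- The **noise path of a skeleton `x` and a remainder `ρ`** along the noise vectors `v₁, v₂`:
`n_{x,ρ}(t) = ρ(t̄) + PL^m_{x₁}(t⁺) v₁ + PL^m_{x₂}(t⁺) v₂` (`t̄` the projection of `t` to `[0,1]`,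
`PL^m` the piecewise-linear interpolation of `BrownianSkeleton.lean`; the remainder takes values in
a subspace `F`, the noise subspace). [folklore] -/
def skelNoisePath {F : Submodule ℝ E} (m : ℕ) (v₁ v₂ : E) (x : PairSkeleton m) (ρ : C(I, F))
    (t : ℝ) : E :=
  (ρ (projIcc 0 1 zero_le_one t) : E) + (plInterp m x.1 t.toNNReal • v₁ + plInterp m x.2 t.toNNReal • v₂)

section Noise

variable {F : Submodule ℝ E} (m : ℕ) (v₁ v₂ : E)

/-- Unfolding `skelNoisePath`. [folklore] -/
theorem skelNoisePath_apply (x : PairSkeleton m) (ρ : C(I, F)) (t : ℝ) :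
    skelNoisePath m v₁ v₂ x ρ t =
      (ρ (projIcc 0 1 zero_le_one t) : E) +
        (plInterp m x.1 t.toNNReal • v₁ + plInterp m x.2 t.toNNReal • v₂) := rfl

/-- The noise path is continuous in time. [folklore] -/
theorem continuous_skelNoisePath (x : PairSkeleton m) (ρ : C(I, F)) :
    Continuous (skelNoisePath m v₁ v₂ x ρ) := by
  unfold skelNoisePath
  have h1 : Continuous fun t : ℝ => ((ρ (projIcc 0 1 zero_le_one t) : F) : E) :=
    continuous_subtype_val.comp ((map_continuous ρ).comp continuous_projIcc)
  have h2 : Continuous fun t : ℝ => plInterp m x.1 t.toNNReal :=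
    (continuous_plInterp m x.1).comp continuous_real_toNNReal
  have h3 : Continuous fun t : ℝ => plInterp m x.2 t.toNNReal :=
    (continuous_plInterp m x.2).comp continuous_real_toNNReal
  exact h1.add ((h2.smul continuous_const).add (h3.smul continuous_const))

/-- The noise path takes values in `F` when `v₁, v₂ ∈ F`. [folklore] -/
theorem skelNoisePath_mem (h₁ : v₁ ∈ F) (h₂ : v₂ ∈ F) (x : PairSkeleton m) (ρ : C(I, F)) (t : ℝ) :
    skelNoisePath m v₁ v₂ x ρ t ∈ F :=
  F.add_mem (ρ _).2 (F.add_mem (F.smul_mem _ h₁) (F.smul_mem _ h₂))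

/-- The zero parameter has the zero noise path. [folklore] -/
theorem skelNoisePath_zero : skelNoisePath m v₁ v₂ (0 : PairSkeleton m) (0 : C(I, F)) = 0 := by
  funext t
  simp [skelNoisePath, plInterp]

/-- **The forcing is a continuous linear map of the parameters**: there is a continuous linear map
`g : E × (ℝ^{2^m})² × C(I, F) →L C(I, E)` with `g(z, x, ρ)(τ) = z + n_{x,ρ}(τ)`. [folklore] -/
theorem exists_skelForcingCLM :
    ∃ g : E × PairSkeleton m × C(I, F) →L[ℝ] C(I, E),
      ∀ (p : E × PairSkeleton m × C(I, F)) (τ : I),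
        g p τ = p.1 + skelNoisePath m v₁ v₂ p.2.1 p.2.2 τ := by
  -- the skeleton part, a linear map from a finite-dimensional space
  let skelFun : PairSkeleton m → C(I, E) := fun x =>
    ⟨fun τ => plInterp m x.1 (τ : ℝ).toNNReal • v₁ + plInterp m x.2 (τ : ℝ).toNNReal • v₂, by
      have h2 : Continuous fun τ : I => plInterp m x.1 (τ : ℝ).toNNReal :=
        (continuous_plInterp m x.1).comp (continuous_real_toNNReal.comp continuous_subtype_val)
      have h3 : Continuous fun τ : I => plInterp m x.2 (τ : ℝ).toNNReal :=
        (continuous_plInterp m x.2).comp (continuous_real_toNNReal.comp continuous_subtype_val)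
      exact (h2.smul continuous_const).add (h3.smul continuous_const)⟩
  let skelLM : PairSkeleton m →ₗ[ℝ] C(I, E) :=
    { toFun := skelFun
      map_add' := fun x x' => by
        ext τ
        simp only [skelFun, ContinuousMap.coe_mk, ContinuousMap.add_apply, Prod.fst_add,
          Prod.snd_add, plInterp_add, add_smul]
        abel
      map_smul' := fun c x => by
        ext τ
        simp only [skelFun, ContinuousMap.coe_mk, ContinuousMap.smul_apply, Prod.smul_fst,
          Prod.smul_snd, plInterp_smul, RingHom.id_apply, smul_add, mul_smul] }
  let skelCLM : PairSkeleton m →L[ℝ] C(I, E) := LinearMap.toContinuousLinearMap skelLM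
  -- the remainder embedding and the constant path
  let rem : C(I, F) →L[ℝ] C(I, E) := F.subtypeL.compLeftContinuous ℝ I
  let cst : E →L[ℝ] C(I, E) := ContinuousLinearMap.const ℝ I
  -- assemble
  let fstP := ContinuousLinearMap.fst ℝ E (PairSkeleton m × C(I, F))
  let sndP := ContinuousLinearMap.snd ℝ E (PairSkeleton m × C(I, F))
  let xP := (ContinuousLinearMap.fst ℝ (PairSkeleton m) C(I, F)).comp sndP
  let ρP := (ContinuousLinearMap.snd ℝ (PairSkeleton m) C(I, F)).comp sndP
  refine ⟨cst.comp fstP + (rem.comp ρP + skelCLM.comp xP), fun p τ => ?_⟩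
  have h1 : (cst.comp fstP + (rem.comp ρP + skelCLM.comp xP)) p τ =
      p.1 + ((p.2.2 τ : E) + skelFun p.2.1 τ) := rfl
  rw [h1, skelNoisePath_apply]
  have hτ : projIcc 0 1 zero_le_one (τ : ℝ) = τ := projIcc_val zero_le_one τ
  rw [hτ]
  rfl

end Noise

/-! ### The remainder noise of a pair of paths -/

section Rem

variable {F : Submodule ℝ E} (m : ℕ) {v₁ v₂ : E} (h₁ : v₁ ∈ F) (h₂ : v₂ ∈ F)

/-- The **remainder noise path** of a pair of raw paths on `[0, 1]`:
`ρ_ω(τ) = R¹_τ(ω) v₁ + R²_τ(ω) v₂`, `R = pairRem m ω` (continuous, with values in `F`). [folklore] -/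
def remNoisePath (w : WienerPair) : C(I, F) :=
  ⟨fun τ => ⟨(pairRem m w).1 ⟨(τ : ℝ), τ.2.1⟩ • v₁ + (pairRem m w).2 ⟨(τ : ℝ), τ.2.1⟩ • v₂,
      F.add_mem (F.smul_mem _ h₁) (F.smul_mem _ h₂)⟩, by
    have hc : Continuous fun τ : I => (⟨(τ : ℝ), τ.2.1⟩ : ℝ≥0) :=
      continuous_subtype_val.subtype_mk _
    have hc1 : Continuous fun τ : I => (pairRem m w).1 ⟨(τ : ℝ), τ.2.1⟩ :=
      (continuous_pairRem_fst m w).comp hc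
    have hc2 : Continuous fun τ : I => (pairRem m w).2 ⟨(τ : ℝ), τ.2.1⟩ :=
      (continuous_pairRem_snd m w).comp hc
    exact ((hc1.smul continuous_const).add (hc2.smul continuous_const)).subtype_mk _⟩

/-- Unfolding `remNoisePath`. [folklore] -/
theorem remNoisePath_apply (w : WienerPair) (τ : I) :
    (remNoisePath m h₁ h₂ w τ : E) =
      (pairRem m w).1 ⟨(τ : ℝ), τ.2.1⟩ • v₁ + (pairRem m w).2 ⟨(τ : ℝ), τ.2.1⟩ • v₂ := rfl

/-- **On `[0, 1]` the Brownian noise path is the skeleton noise path of its skeleton and its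
remainder**: `pairNoise v₁ v₂ (pairPath ω) t = n_{pairSkel ω, ρ_ω}(t)` for `t ∈ [0, 1]`.
[folklore] -/
theorem pairNoise_pairPath_eq_skelNoisePath (w : WienerPair) {t : ℝ} (ht : t ∈ Icc (0 : ℝ) 1) :
    pairNoise v₁ v₂ (pairPath w) t = skelNoisePath m v₁ v₂ (pairSkel m w) (remNoisePath m h₁ h₂ w) t := by
  rw [pairNoise_pairPath, skelNoisePath_apply]
  have hproj : projIcc 0 1 zero_le_one t = ⟨t, ht⟩ := projIcc_of_mem zero_le_one ht
  rw [hproj, remNoisePath_apply]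
  have htnn : t.toNNReal = ⟨t, ht.1⟩ := Real.toNNReal_of_nonneg ht.1
  have hB1 : brownian t.toNNReal w.1 = plInterp m (pairSkel m w).1 t.toNNReal + (pairRem m w).1 ⟨t, ht.1⟩ := by
    have h := plInterp_dyadicIncr_add_bridgeRem m (pairPath w).1 t.toNNReal
    rw [htnn] at h ⊢
    exact h.symm
  have hB2 : brownian t.toNNReal w.2 = plInterp m (pairSkel m w).2 t.toNNReal + (pairRem m w).2 ⟨t, ht.1⟩ := by
    have h := plInterp_dyadicIncr_add_bridgeRem m (pairPath w).2 t.toNNReal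
    rw [htnn] at h ⊢
    exact h.symm
  simp only [hB1, hB2, add_smul]
  show _ = (pairRem m w).1 ⟨t, ht.1⟩ • v₁ + (pairRem m w).2 ⟨t, ht.1⟩ • v₂ + _
  abel

end Rem

/-! ### The solution family and its smoothness -/

namespace ConfinedDrift

variable [FiniteDimensional ℝ E] [CompleteSpace E] {Y : E → E} (D : ConfinedDrift Y)
  (m : ℕ) {v₁ v₂ : E} (hv₁ : v₁ ∈ D.noise) (hv₂ : v₂ ∈ D.noise)
  (g : E × PairSkeleton m × C(I, D.noise) →L[ℝ] C(I, E))
  (hg : ∀ (p : E × PairSkeleton m × C(I, D.noise)) (τ : I),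
    g p τ = p.1 + skelNoisePath m v₁ v₂ p.2.1 p.2.2 τ)
include D hv₁ hv₂ hg

/-- **The solution family and its smoothness.** There is a map
`S : E × (ℝ^{2^m})² × C(I, noise) → C(I, E)` with `S(z, x, ρ)(τ) = Φ_τ(z, n_{x,ρ})` (the pathwise
flow `drivenFlow`), which is the unique zero of the parametric Robbin map of the drift `Y` and the
forcing `g` (the unique continuous solution on `[0, 1]` of
`α(τ) = z + n_{x,ρ}(τ) + ∫₀^τ Y(α(s)) ds`), and is `C^n` jointly in `(z, x, ρ)` if `Y ∈ C^n`,
`n ≥ 1`. [folklore] -/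
theorem exists_skelSol {n : ℕ∞} (hn : 1 ≤ n) (hY : ContDiff ℝ n Y) :
    ∃ S : E × PairSkeleton m × C(I, D.noise) → C(I, E),
      (∀ p τ, S p τ = drivenFlow Y p.1 (skelNoisePath m v₁ v₂ p.2.1 p.2.2) τ) ∧
      (∀ p, forcedRobbinMap Y g (p, S p) = 0) ∧
      (∀ p α, forcedRobbinMap Y g (p, α) = 0 → α = S p) ∧
      ContDiff ℝ n S := by
  have hYc : Continuous Y := D.contDiff_drift.continuous
  have hηc : ∀ (x : PairSkeleton m) (ρ : C(I, D.noise)), Continuous (skelNoisePath m v₁ v₂ x ρ) :=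
    continuous_skelNoisePath m v₁ v₂
  have hηS : ∀ (x : PairSkeleton m) (ρ : C(I, D.noise)) (t : ℝ), skelNoisePath m v₁ v₂ x ρ t ∈ D.noise :=
    skelNoisePath_mem m v₁ v₂ hv₁ hv₂
  -- the family
  let S : E × PairSkeleton m × C(I, D.noise) → C(I, E) := fun p =>
    ⟨fun τ => drivenFlow Y p.1 (skelNoisePath m v₁ v₂ p.2.1 p.2.2) τ,
      (D.continuous_flow p.1 (hηc p.2.1 p.2.2) (hηS p.2.1 p.2.2)).comp continuous_subtype_val⟩
  have hSapply : ∀ p τ, S p τ = drivenFlow Y p.1 (skelNoisePath m v₁ v₂ p.2.1 p.2.2) τ := fun p τ => rfl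
  -- the forcing of the integral equation is `g`
  have hforcing : ∀ (p : E × PairSkeleton m × C(I, D.noise)) (τ : I),
      p.1 + skelNoisePath m v₁ v₂ p.2.1 p.2.2 τ = g p τ := fun p τ => by rw [hg]
  -- `S p` is a zero of the Robbin map
  have hS : ∀ p, forcedRobbinMap Y g (p, S p) = 0 := by
    intro p
    rw [forcedRobbinMap_eq_zero_iff]
    intro τ
    have hsol := D.isIntegralSolutionOn_flow p.1 (hηc p.2.1 p.2.2) (hηS p.2.1 p.2.2) 1 τ τ.2
    rw [hSapply, hsol]
    dsimp only
    rw [hforcing]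
    congr 1
    refine intervalIntegral.integral_congr fun s hs => ?_
    rw [uIcc_of_le τ.2.1] at hs
    have hs1 : s ∈ Icc (0 : ℝ) 1 := ⟨hs.1, hs.2.trans τ.2.2⟩
    rw [IccExtend_nemytskii_of_mem hYc (S p) hs1]
    rfl
  -- uniqueness
  have huniq : ∀ p α, forcedRobbinMap Y g (p, α) = 0 → α = S p := by
    intro p α hα
    rw [forcedRobbinMap_eq_zero_iff] at hα
    set αe : ℝ → E := IccExtend zero_le_one α with hαe
    have hαc : Continuous αe := (map_continuous α).Icc_extend'
    have hsolα : IsIntegralSolutionOn Y (fun t => p.1 + skelNoisePath m v₁ v₂ p.2.1 p.2.2 t) αe 1 := by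
      intro t ht
      have h1 := hα ⟨t, ht⟩
      rw [hαe, IccExtend_of_mem zero_le_one α ht, h1, ← hforcing p ⟨t, ht⟩]
      congr 1
      refine intervalIntegral.integral_congr fun s hs => ?_
      rw [uIcc_of_le ht.1] at hs
      have hs1 : s ∈ Icc (0 : ℝ) 1 := ⟨hs.1, hs.2.trans ht.2⟩
      rw [IccExtend_nemytskii_of_mem hYc α hs1, IccExtend_of_mem zero_le_one α hs1]
    have heq := D.eqOn_flow p.1 (hηc p.2.1 p.2.2) (hηS p.2.1 p.2.2) hsolα hαc
    refine ContinuousMap.ext fun τ => ?_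
    have h1 := heq τ.2
    rw [hαe, IccExtend_of_mem zero_le_one α τ.2] at h1
    rw [hSapply]
    exact h1
  -- smoothness
  have hsmooth : ContDiff ℝ n S :=
    contDiff_iff_contDiffAt.2 fun p₀ => contDiffAt_forcedSolution_family hY g.contDiff hn hS huniq p₀
  exact ⟨S, hSapply, hS, huniq, hsmooth⟩

omit hv₁ hv₂ hg in
/-- **At an equilibrium and zero noise the solution is the constant path**: if `Y x₀ = 0` then
`S(x₀, 0, 0) = x₀` (the constant path solves the integral equation with zero data). [folklore] -/
theorem skelSol_equilibrium {S : E × PairSkeleton m × C(I, D.noise) → C(I, E)}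
    (hS : ∀ p τ, S p τ = drivenFlow Y p.1 (skelNoisePath m v₁ v₂ p.2.1 p.2.2) τ) {x₀ : E}
    (hx₀ : Y x₀ = 0) :
    S (x₀, 0, 0) = ContinuousMap.const I x₀ := by
  have hη0 : skelNoisePath m v₁ v₂ (0 : PairSkeleton m) (0 : C(I, D.noise)) = 0 :=
    skelNoisePath_zero m v₁ v₂
  have hsol : IsIntegralSolutionOn Y (fun t => x₀ + (0 : ℝ → E) t) (fun _ => x₀) 1 := by
    intro t _
    simp [hx₀]
  refine ContinuousMap.ext fun τ => ?_
  rw [hS, ContinuousMap.const_apply]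
  show drivenFlow Y x₀ (skelNoisePath m v₁ v₂ 0 0) τ = x₀
  rw [hη0]
  exact (D.eqOn_flow x₀ continuous_zero (fun _ => D.noise.zero_mem) hsol continuous_const τ.2).symm

omit hg in
/-- **The SDE solution at time `1` through the skeleton**: for every pair of raw paths `ω` and every
initial condition `z`, `Φ_1(z, B(ω)) = S(z, pairSkel m ω, ρ_ω)(1)` — the flow on `[0, 1]` only sees
the noise on `[0, 1]`, where the Brownian noise path is the skeleton noise path of its skeleton and
remainder (`pairNoise_pairPath_eq_skelNoisePath`). [folklore] -/
theorem sdeSolMap_one_eq_skelSol {S : E × PairSkeleton m × C(I, D.noise) → C(I, E)}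
    (hS : ∀ p τ, S p τ = drivenFlow Y p.1 (skelNoisePath m v₁ v₂ p.2.1 p.2.2) τ)
    (w : WienerPair) (z : E) :
    sdeSolMap Y v₁ v₂ 1 z (pairPath w) = S (z, pairSkel m w, remNoisePath m hv₁ hv₂ w) 1 := by
  rw [hS]
  show drivenFlow Y z (pairNoise v₁ v₂ (pairPath w)) 1 =
    drivenFlow Y z (skelNoisePath m v₁ v₂ (pairSkel m w) (remNoisePath m hv₁ hv₂ w)) ((1 : I) : ℝ)
  refine D.flow_congr z (continuous_pairNoise v₁ v₂ (pairPath w)) (continuous_skelNoisePath m v₁ v₂ _ _)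
    (fun t => pairNoise_mem v₁ v₂ hv₁ hv₂ _ t) (skelNoisePath_mem m v₁ v₂ hv₁ hv₂ _ _) (T := 1)
    (fun t ht => pairNoise_pairPath_eq_skelNoisePath m hv₁ hv₂ w ht) ⟨zero_le_one, le_rfl⟩

omit hg in
/-- The same at every time `τ ∈ [0, 1]`. [folklore] -/
theorem sdeSolMap_eqOn_skelSol {S : E × PairSkeleton m × C(I, D.noise) → C(I, E)}
    (hS : ∀ p τ, S p τ = drivenFlow Y p.1 (skelNoisePath m v₁ v₂ p.2.1 p.2.2) τ)
    (w : WienerPair) (z : E) (τ : I) :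
    sdeSolMap Y v₁ v₂ τ z (pairPath w) = S (z, pairSkel m w, remNoisePath m hv₁ hv₂ w) τ := by
  rw [hS]
  exact D.flow_congr z (continuous_pairNoise v₁ v₂ (pairPath w)) (continuous_skelNoisePath m v₁ v₂ _ _)
    (fun t => pairNoise_mem v₁ v₂ hv₁ hv₂ _ t) (skelNoisePath_mem m v₁ v₂ hv₁ hv₂ _ _) (T := 1)
    (fun t ht => pairNoise_pairPath_eq_skelNoisePath m hv₁ hv₂ w ht) τ.2

end ConfinedDrift

end Literature.MathematicalPhysics.KineticTheory

end
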